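import Mathlib
import HarnessLib
import Summits.SmoothPoincare4.Statement
import Literature.Topology.FourManifolds.HomotopySpheres
import Literature.Topology.FourManifolds.Gluing
import Literature.Topology.FourManifolds.Handles
import Literature.Topology.FourManifolds.CerfGammaFourProofs
import Summits.SmoothPoincare4.SmoothPoincare4.Theses.RootDecompAE

/-!
# Line «seam-rigidity» for the crux `RootDecompAE.NonSeifertTwistedDoubleResidual` (stmt-SmoothPoincare4-32001)

SKELETON (decomp-sp4 lens 2 «structural dichotomy», gen 11; CRUX-PLAN shape (A); writer W1 form: hypothesis-free composition only, stub
statements INLINED over tree/Mathlib declarations, no local defs): four registered stubs and the kernel-checked composition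
`NonSeifertTwistedDoubleResidual_of : …RootDecompAE.NonSeifertTwistedDoubleResidual` (concludes the crux BY NAME, by cases, using
`stub_seamFloorMazur` / `stub_seamFiniteMod` / `stub_seamInfiniteMod` / `stub_seamTail` directly — the binder form
`MazurDoubleSphereFour → MFM → MIM → NMR → NTD` and the exactness `NTD ⟺ MFM ∧ MIM ∧ NMR` (given STD) are the lens kernel's, SeamRigidity.lean).
Cut = structural TRICHOTOMY on the MAPPING CLASS GROUP OF THE SEAM MANIFOLD ∂C of a MAZUR-TYPE piece C, read off π₁(∂C) a priori
(Out(π₁ ∂C) trivial / finite / infinite; dictionary MCG(Y) ≅ Out(π₁ Y) for closed irreducible Y with infinite π₁ — Aschenbrenner–Friedl–Wilton,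
3-manifold groups, Thm p.14, stated for irreducible seam manifolds = every cork boundary in print; the typed strata are predicates on π₁(∂C) alone):
* `stub_seamFloorMazur` — FLOOR, an IN-TREE THEOREM: verbatim the named fact `Literature.Topology.FourManifolds.Mazur1961_double_sphere_four`
  (MazurDouble.lean:46), proved in tree by `Literature.Topology.FourManifolds.Mazur1961_double_sphere_four_holds` (MazurDoubleHolds.lean:2570);
  a stub ONLY because the farm snapshot has `MazurDouble(Holds)` unbuilt — closes by `exact Literature.Topology.FourManifolds.Mazur1961_double_sphere_four_holds`
  once built (same body ⇒ defeq; same statement as `stub_mazurDouble` of Lines/mazur_seams.lean on #32000);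
* `stub_seamFiniteMod`   — LOAD-BEARING (species R; FINITELY MANY ROWS PER PIECE): Mazur-type piece whose seam manifold has infinite π₁ with FINITE Out(π₁),
  non-Seifert seam manifold, non-extendable (loose-cork) seam ⟹ C ∪_ψ C ≅ S⁴ for X ≃ₕ S⁴ (rigid sub-stratum Out = 1 is a theorem mod the cited fact «rigid seams extend»);
* `stub_seamInfiniteMod` — DECLARED RESIDUAL of the Mazur side (species R; explicit rows = Gompf's ℤ-cork twisted doubles 𝒟_{m,n}(K), u(K) ≥ 2 & m odd open):
  Mazur-type piece, seam manifold neither Seifert nor finite-Mod, non-extendable seam ⟹ standard;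
* `stub_seamTail`        — the SHRUNKEN species-E tail: X ≃ₕ S⁴ with NEITHER a Seifert-seam NOR a Mazur-piece twisted-double structure ⟹ X ≅ S⁴
  (NTD's hypothesis verbatim + one more).
The Mazur-type + extendable-seam stratum is discharged INSIDE the composition (`mazurExtendableSeams_standard`, from `stub_seamFloorMazur` and the
tree's `IsBoundaryGluing.isDouble_of_extends`).  Sorries: exactly 4, one per `stub_*`; nothing else.  Line card: `Lines/seam_rigidity.md`.
-/

set_option linter.dupNamespace false

noncomputable section

open scoped Manifold ContDiff Topology
open Set Function Literature.Topology.FourManifolds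

namespace Summit.SmoothPoincare4.SmoothPoincare4.Cruxes.NonSeifertTwistedDoubleResidual.SeamRigidity

/-! ### Registered stubs -/

/-- FLOOR stub (in-tree theorem; closes by `exact Literature.Topology.FourManifolds.Mazur1961_double_sphere_four_holds` once the farm builds
`Literature.Topology.FourManifolds.MazurDoubleHolds`). -/
theorem stub_seamFloorMazur :
  ∀ (W : Type) [TopologicalSpace W] [T2Space W] [SecondCountableTopology W]
    [ChartedSpace (EuclideanHalfSpace 4) W] [IsManifold (𝓡∂ 4) ∞ W] [CompactSpace W]
    [ContractibleSpace W],
    HasHandleDecomposition 3 W (fun k => if k ≤ 2 then 1 else 0) →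
    ∀ (b : BoundaryData (𝓡∂ 4) W (𝓡 3))
      (P : Type) [TopologicalSpace P] [T2Space P] [SecondCountableTopology P]
      [ChartedSpace (EuclideanSpace ℝ (Fin 4)) P] [IsManifold (𝓡 4) ∞ P],
    IsDouble b (𝓡 4) P → Nonempty (P ≃ₘ⟮𝓡 4, 𝓡 4⟯ Metric.sphere (0 : EuclideanSpace ℝ (Fin 5)) 1) := by
  sorry

/-- LOAD-BEARING stub MFM «Mazur finite-Mod seams are standard» (species R; finitely many rows per piece; rows and instrument T-SEAM-FIN in
`Lines/seam_rigidity.md`).  Hypotheses in order: Mazur type; seam manifold NOT Seifert; seam manifold π₁ infinite with finitely many outer automorphism classes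
(∃ finite S ⊂ Aut with every automorphism ≡ some σ ∈ S mod Inn); the seam does not extend over C.  Seifert seams belong to the sibling
STD #32000 / line «mazur-seams». -/
theorem stub_seamFiniteMod :
  ∀ (C : Type) [TopologicalSpace C] [T2Space C] [SecondCountableTopology C] [ChartedSpace (EuclideanHalfSpace 4) C]
    [IsManifold (𝓡∂ 4) ∞ C] [CompactSpace C] [ContractibleSpace C] (bC : BoundaryData (𝓡∂ 4) C (𝓡 3))
    (ψ : bC.carrier ≃ₘ⟮𝓡 3, 𝓡 3⟯ bC.carrier),
    HasHandleDecomposition 3 C (fun k => if k ≤ 2 then 1 else 0) →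
    (¬ ∃ (y : bC.carrier) (g : FundamentalGroup bC.carrier y), ¬ IsOfFinOrder g ∧ (Subgroup.zpowers g).Normal) →
    (∃ y : bC.carrier, Infinite (FundamentalGroup bC.carrier y) ∧
      ∃ S : Set (FundamentalGroup bC.carrier y ≃* FundamentalGroup bC.carrier y), S.Finite ∧
        ∀ φ : FundamentalGroup bC.carrier y ≃* FundamentalGroup bC.carrier y,
          ∃ σ ∈ S, ∃ g : FundamentalGroup bC.carrier y, ∀ x, φ x = g * σ x * g⁻¹) →
    (¬ ∃ Φ : C ≃ₘ⟮𝓡∂ 4, 𝓡∂ 4⟯ C, ∀ z, Φ (bC.incl z) = bC.incl (ψ z)) →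
    ∀ (X : Type) [TopologicalSpace X] [T2Space X] [SecondCountableTopology X] [ChartedSpace (EuclideanSpace ℝ (Fin 4)) X]
    [IsManifold (𝓡 4) ∞ X], ContinuousMap.HomotopyEquiv X (Metric.sphere (0 : EuclideanSpace ℝ (Fin 5)) 1) →
      IsBoundaryGluing bC bC ψ (𝓡 4) X → Nonempty (X ≃ₘ⟮𝓡 4, 𝓡 4⟯ Metric.sphere (0 : EuclideanSpace ℝ (Fin 5)) 1) := by
  sorry

/-- DECLARED-RESIDUAL stub MIM «Mazur infinite-Mod (toroidal) seams are standard» (species R; Gompf ℤ-cork rows; `Lines/seam_rigidity.md`).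
Hypotheses in order: Mazur type; seam manifold NOT Seifert (AE's predicate verbatim, negated); seam manifold NOT finite-Mod (negation of
`stub_seamFiniteMod`'s hypothesis); the seam does not extend over C. -/
theorem stub_seamInfiniteMod :
  ∀ (C : Type) [TopologicalSpace C] [T2Space C] [SecondCountableTopology C] [ChartedSpace (EuclideanHalfSpace 4) C]
    [IsManifold (𝓡∂ 4) ∞ C] [CompactSpace C] [ContractibleSpace C] (bC : BoundaryData (𝓡∂ 4) C (𝓡 3))
    (ψ : bC.carrier ≃ₘ⟮𝓡 3, 𝓡 3⟯ bC.carrier),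
    HasHandleDecomposition 3 C (fun k => if k ≤ 2 then 1 else 0) →
    (¬ ∃ (y : bC.carrier) (g : FundamentalGroup bC.carrier y), ¬ IsOfFinOrder g ∧ (Subgroup.zpowers g).Normal) →
    (¬ ∃ y : bC.carrier, Infinite (FundamentalGroup bC.carrier y) ∧
      ∃ S : Set (FundamentalGroup bC.carrier y ≃* FundamentalGroup bC.carrier y), S.Finite ∧
        ∀ φ : FundamentalGroup bC.carrier y ≃* FundamentalGroup bC.carrier y,
          ∃ σ ∈ S, ∃ g : FundamentalGroup bC.carrier y, ∀ x, φ x = g * σ x * g⁻¹) →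
    (¬ ∃ Φ : C ≃ₘ⟮𝓡∂ 4, 𝓡∂ 4⟯ C, ∀ z, Φ (bC.incl z) = bC.incl (ψ z)) →
    ∀ (X : Type) [TopologicalSpace X] [T2Space X] [SecondCountableTopology X] [ChartedSpace (EuclideanSpace ℝ (Fin 4)) X]
    [IsManifold (𝓡 4) ∞ X], ContinuousMap.HomotopyEquiv X (Metric.sphere (0 : EuclideanSpace ℝ (Fin 5)) 1) →
      IsBoundaryGluing bC bC ψ (𝓡 4) X → Nonempty (X ≃ₘ⟮𝓡 4, 𝓡 4⟯ Metric.sphere (0 : EuclideanSpace ℝ (Fin 5)) 1) := by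
  sorry

/-- TAIL stub NMR «non-Mazur non-Seifert residual» (species E, strictly inside NTD's tail): X ≃ₕ S⁴ with NO Seifert-seam twisted-double structure
(NTD's hypothesis verbatim) and NO Mazur-piece twisted-double structure is S⁴. -/
theorem stub_seamTail :
  ∀ (X : Type) [TopologicalSpace X] [T2Space X] [SecondCountableTopology X] [ChartedSpace (EuclideanSpace ℝ (Fin 4)) X]
    [IsManifold (𝓡 4) ∞ X], ContinuousMap.HomotopyEquiv X (Metric.sphere (0 : EuclideanSpace ℝ (Fin 5)) 1) →
    (¬ ∃ (C : Type) (_ : TopologicalSpace C) (_ : T2Space C) (_ : SecondCountableTopology C)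
        (_ : ChartedSpace (EuclideanHalfSpace 4) C) (_ : IsManifold (𝓡∂ 4) ∞ C) (_ : CompactSpace C) (_ : ContractibleSpace C)
        (bC : BoundaryData (𝓡∂ 4) C (𝓡 3)) (ψ : bC.carrier ≃ₘ⟮𝓡 3, 𝓡 3⟯ bC.carrier),
        (∃ (y : bC.carrier) (g : FundamentalGroup bC.carrier y), ¬ IsOfFinOrder g ∧ (Subgroup.zpowers g).Normal) ∧
        IsBoundaryGluing bC bC ψ (𝓡 4) X) →
    (¬ ∃ (C : Type) (_ : TopologicalSpace C) (_ : T2Space C) (_ : SecondCountableTopology C)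
        (_ : ChartedSpace (EuclideanHalfSpace 4) C) (_ : IsManifold (𝓡∂ 4) ∞ C) (_ : CompactSpace C) (_ : ContractibleSpace C)
        (bC : BoundaryData (𝓡∂ 4) C (𝓡 3)) (ψ : bC.carrier ≃ₘ⟮𝓡 3, 𝓡 3⟯ bC.carrier),
        HasHandleDecomposition 3 C (fun k => if k ≤ 2 then 1 else 0) ∧ IsBoundaryGluing bC bC ψ (𝓡 4) X) →
    Nonempty (X ≃ₘ⟮𝓡 4, 𝓡 4⟯ Metric.sphere (0 : EuclideanSpace ℝ (Fin 5)) 1) := by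
  sorry

/-! ### Kernel-checked composition -/

section Seam

variable {C : Type} [TopologicalSpace C] [ChartedSpace (EuclideanHalfSpace 4) C] [IsManifold (𝓡∂ 4) ∞ C]
  {bC : BoundaryData (𝓡∂ 4) C (𝓡 3)} {ψ : bC.carrier ≃ₘ⟮𝓡 3, 𝓡 3⟯ bC.carrier}
  {X : Type} [TopologicalSpace X] [ChartedSpace (EuclideanSpace ℝ (Fin 4)) X]

/-- If the seam `ψ` of `X = C ∪_ψ C` is the boundary restriction of a self-diffeomorphism `Φ` of `C`, then `X` is the double `C ∪_id C`
(tree `IsBoundaryGluing.isDouble_of_extends` applied to `Φ⁻¹`). -/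
theorem isDouble_of_seam_extends (h : IsBoundaryGluing bC bC ψ (𝓡 4) X) (Φ : C ≃ₘ⟮𝓡∂ 4, 𝓡∂ 4⟯ C)
    (hΦ : ∀ z, Φ (bC.incl z) = bC.incl (ψ z)) : IsDouble bC (𝓡 4) X := by
  refine IsBoundaryGluing.isDouble_of_extends (φ := ψ.toEquiv) h Φ.symm fun z => ?_
  have h1 : Φ (bC.incl (ψ.symm z)) = bC.incl z := by
    rw [hΦ, Diffeomorph.apply_symm_apply]
  change Φ.symm (bC.incl z) = bC.incl (ψ.symm z)
  rw [← h1, Diffeomorph.symm_apply_apply]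

end Seam

/-- **COMPOSITION (concludes the crux BY NAME, hypothesis-free; W1 form)**: by cases on «X has a Mazur-piece twisted-double structure»,
«its seam extends over the piece», «its seam manifold is finite-Mod», using the four registered stubs directly. -/
theorem NonSeifertTwistedDoubleResidual_of :
    Summit.SmoothPoincare4.SmoothPoincare4.Theses.RootDecompAE.NonSeifertTwistedDoubleResidual := by
  intro X _ _ _ _ _ e hnoSeif
  by_cases hMaz : ∃ (C : Type) (_ : TopologicalSpace C) (_ : T2Space C) (_ : SecondCountableTopology C)
      (_ : ChartedSpace (EuclideanHalfSpace 4) C) (_ : IsManifold (𝓡∂ 4) ∞ C) (_ : CompactSpace C) (_ : ContractibleSpace C)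
      (bC : BoundaryData (𝓡∂ 4) C (𝓡 3)) (ψ : bC.carrier ≃ₘ⟮𝓡 3, 𝓡 3⟯ bC.carrier),
      HasHandleDecomposition 3 C (fun k => if k ≤ 2 then 1 else 0) ∧ IsBoundaryGluing bC bC ψ (𝓡 4) X
  · obtain ⟨C, _, _, _, _, _, _, _, bC, ψ, hM, hglue⟩ := hMaz
    -- the seam manifold is not Seifert (else X would be a Seifert-seam twisted double, excluded by NTD's hypothesis)
    have hnS : ¬ ∃ (y : bC.carrier) (g : FundamentalGroup bC.carrier y), ¬ IsOfFinOrder g ∧ (Subgroup.zpowers g).Normal :=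
      fun ⟨y, g, hg⟩ => hnoSeif ⟨C, ‹_›, ‹_›, ‹_›, ‹_›, ‹_›, ‹_›, ‹_›, bC, ψ, ⟨y, g, hg⟩, hglue⟩
    by_cases hE : ∃ Φ : C ≃ₘ⟮𝓡∂ 4, 𝓡∂ 4⟯ C, ∀ z, Φ (bC.incl z) = bC.incl (ψ z)
    · -- Mazur-type piece with EXTENDABLE seam: the untwisted double, discharged by the floor stub (tree theorem) — no sorry of its own
      obtain ⟨Φ, hΦ⟩ := hE
      exact stub_seamFloorMazur C hM bC X (isDouble_of_seam_extends hglue Φ hΦ)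
    · by_cases hF : ∃ y : bC.carrier, Infinite (FundamentalGroup bC.carrier y) ∧
          ∃ S : Set (FundamentalGroup bC.carrier y ≃* FundamentalGroup bC.carrier y), S.Finite ∧
            ∀ φ : FundamentalGroup bC.carrier y ≃* FundamentalGroup bC.carrier y,
              ∃ σ ∈ S, ∃ g : FundamentalGroup bC.carrier y, ∀ x, φ x = g * σ x * g⁻¹
      · exact stub_seamFiniteMod C bC ψ hM hnS hF hE X e hglue
      · exact stub_seamInfiniteMod C bC ψ hM hnS hF hE X e hglue
  · exact stub_seamTail X e hnoSeif hMaz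

end Summit.SmoothPoincare4.SmoothPoincare4.Cruxes.NonSeifertTwistedDoubleResidual.SeamRigidity

end
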